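import Literature.NumberTheory.EllipticCurves.ShintaniOrbitUnfolding
import Literature.NumberTheory.EllipticCurves.ShintaniNullStabilizers
import Literature.NumberTheory.EllipticCurves.StripFundamentalDomain
import HarnessLib

/-!
# The orbits of non-zero null vectors contribute nothing to the unfolded Shintani lift

[[cite: Shintani1975, §2, proof of Prop. 2.3 (p. 103)]] — "Next, assume `(x, x) = 0`, `x ≠ 0` …
Since `φ` is a cusp form, the above integral is zero."  For the twisted lift on `Γ₀(64)⁺` we PROVE
`∫_{F_{k₀}} term(k₀) = 0` for every `k₀ ≠ 0` with `disc ι♮(k₀) = 0` (`D` odd, `φ ∈ S₂(Γ₀(64))`):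

* `shintaniFn_yTwo` — the kernel term of `λY²` is `λ e^{-4π Im Z λ²/(Im u)²}`, a function of `Im u`;
* `liftTerm_sigma_inv_smul` — with `ι♮(k₀) ∘ σ⁻¹ = λY²` (`ShintaniNullStabilizers`),
  `term(k₀)(σ⁻¹u) = (φ|σ⁻¹)(u) · c_D(k₀) λ e^{-4π Im Z λ²/(Im u)²}`;
* `mdifferentiable_and_isZeroAtImInfty_slash`, `slash_vadd_of_conj_T_mem` — the translate `φ|σ⁻¹`
  is holomorphic, tends to `0` at `i∞` (Mathlib `CuspForm.translate`) and is `n₀`-periodic when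
  `σ⁻¹T^{n₀}σ ∈ Γ₀(64)`;
* **`integral_orbitDomain_eq_zero_of_null`** — the orbit integral over `F_{k₀}`
  (`ShintaniOrbitUnfolding`) equals the integral over the conjugated strip
  (`StripFundamentalDomain`, Mathlib `IsFundamentalDomain.setIntegral_eq`), which vanishes by
  `StripIntegralVanishing`.

No named facts, no definitions.
-/

noncomputable section

open scoped MatrixGroups ModularForm Modular Topology ENNReal Pointwise Manifold
open UpperHalfPlane hiding I
open Complex Filter MeasureTheory Set CongruenceSubgroup ModularGroup Real
open Literature.NumberTheory.EllipticCurves.ModularForms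

namespace Literature.NumberTheory.EllipticCurves.Shintani

variable (D : ℕ) [NeZero D]

/-! ### The kernel term of `λ Y²` -/

/-- `formEval (λY²) u = λ`. [folklore] -/
theorem formEval_yTwo (lam : ℝ) (u : ℂ) : formEval (yTwo lam) u = lam := by
  simp [formEval, yTwo]

/-- `disc (λY²) = 0`. [folklore] -/
theorem disc_yTwo (lam : ℝ) : disc (yTwo lam) = 0 := by simp [disc, yTwo]

/-- `p_u(λY²) = λ / Im u`. [folklore] -/
theorem pw_yTwo (lam : ℝ) (u : ℍ) : pw u (yTwo lam) = lam / u.im := by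
  simp [pw, yTwo]

/-- `q_u⁺(λY²) = 2 λ²/(Im u)²`. [folklore] -/
theorem majorant_yTwo (lam : ℝ) (u : ℍ) : majorant u (yTwo lam) = 2 * (lam / u.im) ^ 2 := by
  rw [majorant, disc_yTwo, pw_yTwo, zero_add]

/-- **The kernel term of `λY²` depends on `Im u` only**:
`f_{u,Z}(λY²) = λ e^{-4π Im Z λ²/(Im u)²}`. [folklore] -/
theorem shintaniFn_yTwo (u Z : ℍ) (lam : ℝ) :
    shintaniFn u Z (yTwo lam) = (lam : ℂ) * cexp (((-(4 * π * Z.im * lam ^ 2 / u.im ^ 2) : ℝ) : ℂ)) := by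
  rw [shintaniFn, formEval_yTwo, disc_yTwo, majorant_yTwo]
  congr 1
  push_cast
  rw [UpperHalfPlane.coe_im]
  ring_nf
  rw [Complex.I_sq]
  ring

/-! ### The term on the strip -/

variable {D}

/-- **The term after moving to the strip**: with `ι♮(k₀) ∘ σ⁻¹ = λ Y²`,
`term(k₀)(σ⁻¹ u) = (φ|σ⁻¹)(u) · c_D(k₀) λ e^{-4π Im Z λ²/(Im u)²}`. [folklore] -/
theorem liftTerm_sigma_inv_smul (f : CuspForm (Gamma0 64) 2) (z : ℍ) {k₀ : Fin 3 → ℤ} {σ : SL(2, ℤ)}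
    {lam : ℝ} (hσ : actM σ⁻¹ (latSharp k₀) = yTwo lam) (u : ℍ) :
    liftTerm D f z k₀ (σ⁻¹ • u) = (⇑f ∣[(2 : ℤ)] σ⁻¹) u * (cD D k₀ * ((lam : ℂ) *
      cexp (((-(4 * π * (zScaled D z).im * lam ^ 2 / u.im ^ 2) : ℝ) : ℂ)))) := by
  set g : SL(2, ℤ) := σ⁻¹ with hg
  have hj : (((g 1 0 : ℤ) : ℂ) * u + ((g 1 1 : ℤ) : ℂ)) ≠ 0 := by
    have h := UpperHalfPlane.denom_ne_zero (g : GL (Fin 2) ℝ) u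
    rw [ModularGroup.denom_apply] at h
    exact_mod_cast h
  have h1 := shintaniFn_sl_smul g u (zScaled D z) (latSharp k₀)
  -- `actV (entries of g) (ι k₀) = actM g (ι k₀) = yTwo lam`
  have h2 : actV (g 0 0 : ℤ) (g 0 1 : ℤ) (g 1 0 : ℤ) (g 1 1 : ℤ) (latSharp k₀) = yTwo lam := hσ
  rw [h2, shintaniFn_yTwo] at h1
  have h3 : (⇑f ∣[(2 : ℤ)] g) u = f (g • u) * (((g 1 0 : ℤ) : ℂ) * u + ((g 1 1 : ℤ) : ℂ)) ^ (-(2 : ℤ)) := by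
    rw [ModularForm.SL_slash_apply, ModularGroup.denom_apply]
  unfold liftTerm
  rw [h3]
  have h4 : shintaniFn (g • u) (zScaled D z) (latSharp k₀) =
      ((lam : ℂ) * cexp (((-(4 * π * (zScaled D z).im * lam ^ 2 / u.im ^ 2) : ℝ) : ℂ))) /
        (((g 1 0 : ℤ) : ℂ) * u + ((g 1 1 : ℤ) : ℂ)) ^ 2 := by
    rw [eq_div_iff (pow_ne_zero 2 hj), mul_comm, ← h1]
  rw [h4, _root_.zpow_neg, zpow_ofNat]
  field_simp

/-! ### The translate `φ|σ⁻¹`: holomorphy, periodicity, decay -/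

/-- The translate `φ|A` of a cusp form by `A ∈ SL₂(ℤ)` is holomorphic and tends to `0` at `i∞`.
[folklore] -/
theorem mdifferentiable_and_isZeroAtImInfty_slash (f : CuspForm (Gamma0 64) 2) (A : SL(2, ℤ)) :
    MDifferentiable 𝓘(ℂ) 𝓘(ℂ) (⇑f ∣[(2 : ℤ)] A) ∧ IsZeroAtImInfty (⇑f ∣[(2 : ℤ)] A) := by
  haveI hA : ((ConjAct.toConjAct (A : GL (Fin 2) ℝ)⁻¹) • (Gamma0 64 : Subgroup (GL (Fin 2) ℝ))).IsArithmetic := by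
    simpa [(show Rat.castHom ℝ = algebraMap ℚ ℝ by rfl), map_inv, Matrix.SpecialLinearGroup.map_mapGL]
      using! Subgroup.IsArithmetic.conj (Gamma0 64 : Subgroup (GL (Fin 2) ℝ)) (Matrix.SpecialLinearGroup.mapGL ℚ A)⁻¹
  set g := CuspForm.translate f (A : GL (Fin 2) ℝ) with hg
  have hcoe : ⇑g = (⇑f ∣[(2 : ℤ)] A) := CuspForm.coe_translate f A
  refine ⟨?_, ?_⟩
  · rw [← hcoe]; exact CuspFormClass.holo g
  · rw [← hcoe]; exact CuspFormClass.zero_at_infty g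

/-- **Periodicity of the translate**: if `σ⁻¹ T^n σ ∈ Γ₀(64)` then `(φ|σ⁻¹)(n +ᵥ u) = (φ|σ⁻¹)(u)`.
[folklore] -/
theorem slash_vadd_of_conj_T_mem (f : CuspForm (Gamma0 64) 2) (σ : SL(2, ℤ)) {n : ℤ}
    (hmem : σ⁻¹ * ModularGroup.T ^ n * σ ∈ Gamma0 64) (u : ℍ) :
    (⇑f ∣[(2 : ℤ)] σ⁻¹) (((n : ℝ)) +ᵥ u) = (⇑f ∣[(2 : ℤ)] σ⁻¹) u := by
  set F : ℍ → ℂ := ⇑f ∣[(2 : ℤ)] σ⁻¹ with hF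
  -- `F | T^n = F`
  have hinv : F ∣[(2 : ℤ)] (ModularGroup.T ^ n) = F := by
    rw [hF, ← SlashAction.slash_mul]
    have : σ⁻¹ * ModularGroup.T ^ n = (σ⁻¹ * ModularGroup.T ^ n * σ) * σ⁻¹ := by group
    rw [this, SlashAction.slash_mul]
    congr 1
    have hmemGL : ((σ⁻¹ * ModularGroup.T ^ n * σ : SL(2, ℤ)) : GL (Fin 2) ℝ) ∈
        (Gamma0 64 : Subgroup (GL (Fin 2) ℝ)) := ⟨_, hmem, rfl⟩
    funext w
    rw [ModularForm.slash_action_eq'_iff]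
    have h := SlashInvariantForm.slash_action_eqn'' f hmemGL w
    rw [ModularGroup.denom_apply] at h
    exact h
  have h := (ModularForm.slash_action_eq'_iff (2 : ℤ) F (ModularGroup.T ^ n) u).mp (by rw [hinv])
  rw [UpperHalfPlane.modular_T_zpow_smul] at h
  rw [h, ModularGroup.coe_T_zpow]
  simp

/-! ### The null orbits vanish -/

/-- **The orbit of a non-zero null vector contributes `0`**: for `D` odd, `φ ∈ S₂(Γ₀(64))` and
`k₀ ≠ 0` with `disc ι♮(k₀) = 0`, `∫_{F_{k₀}} term(k₀) = 0` — the stabiliser is a group of conjugated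
translations (`ShintaniNullStabilizers`), a fundamental domain is the conjugated strip
(`StripFundamentalDomain`), on it the term is `(φ|σ⁻¹)(u) · c λ e^{-c'/(Im u)²}`, and the strip
integral vanishes by the cusp-form property (`StripIntegralVanishing`). [cite: Shintani1975, §2,
proof of Prop. 2.3 (p. 103)] -/
theorem integral_orbitDomain_eq_zero_of_null (hD : Odd D) (f : CuspForm (Gamma0 64) 2) (z : ℍ)
    {k₀ : Fin 3 → ℤ} (hnull : disc (latSharp k₀) = 0) (hk : k₀ ≠ 0) :
    ∫ w in orbitDomain k₀, liftTerm D f z k₀ w = 0 := by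
  obtain ⟨σ, lam, n₀, m, hlam, hn₀, hσ, hm, hact, hTmem⟩ := null_stabilizer hnull hk
  have hn₀R : (0 : ℝ) < n₀ := by exact_mod_cast hn₀
  -- the two fundamental domains of the stabiliser
  have hFD := isFundamentalDomain_orbitDomain k₀
  have hFD' : IsFundamentalDomain (stabK k₀) (σ⁻¹ • hstrip (n₀ : ℝ)) (volume : Measure ℍ) := by
    refine isFundamentalDomain_conj_hstrip σ hn₀R m hm (fun γ w ↦ ?_)
    have h := hact γ w
    push_cast at h ⊢
    exact h
  have hinv : ∀ (γ : stabK k₀) (w : ℍ), liftTerm D f z k₀ (γ • w) = liftTerm D f z k₀ w :=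
    liftTerm_stab_invariant D hD f z k₀
  obtain ⟨hint, -⟩ := tsum_quotient_integral_liftTerm_eq hD f z k₀
  rw [hFD.setIntegral_eq hFD' hinv, setIntegral_sl_smul_set]
  have hint' : IntegrableOn (fun u ↦ liftTerm D f z k₀ (σ⁻¹ • u)) (hstrip (n₀ : ℝ)) := by
    rw [← integrableOn_sl_smul_set_iff]
    exact (hFD.integrableOn_iff hFD' hinv).mp hint
  simp_rw [liftTerm_sigma_inv_smul f z hσ] at hint' ⊢
  -- the strip integral of `(φ|σ⁻¹)(u) · G(Im u)` vanishes
  set G : ℝ → ℂ := fun v ↦ cD D k₀ * ((lam : ℂ) *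
    cexp (((-(4 * π * (zScaled D z).im * lam ^ 2 / v ^ 2) : ℝ) : ℂ))) with hG
  obtain ⟨hhol, hzero⟩ := mdifferentiable_and_isZeroAtImInfty_slash f σ⁻¹
  have hper : ∀ u : ℍ, (⇑f ∣[(2 : ℤ)] σ⁻¹) (((n₀ : ℝ)) +ᵥ u) = (⇑f ∣[(2 : ℤ)] σ⁻¹) u := by
    intro u
    have := slash_vadd_of_conj_T_mem f σ (n := (n₀ : ℤ)) (Gamma0Plus_le hTmem) u
    exact_mod_cast this
  exact setIntegral_hstrip_mul_eq_zero (⇑f ∣[(2 : ℤ)] σ⁻¹) hhol hn₀R hper hzero G hint'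

end Literature.NumberTheory.EllipticCurves.Shintani
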